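import Summits.HubbardSuperconductivity.HubbardSuperconductivity.Theorems.WcbcsSsbToTorusLRO.Negative.SummitMatrixUniformFloor
import HarnessLib

/-!
# Crux `JmPairBridge` (stmt-HubbardSuperconductivity-2226), line `Sketch`:
# stub `stub_lroFloorOfHasLRO`

Route `JosephsonMirror`, crux `JmPairBridge` (the every-ground-state pair bridge between adjacent
charge-sector ground floors of the Hubbard torus `hubbardTorus 2 L 1 U` at filling
`N_L = 2⌊(1-δ)L²/2⌋`). This file is the bookkeeping step of the lead skeleton (line `Sketch`) that
converts the summit matrix at a point, `HasDWavePairFieldLROAt U δ` (every admissible sequence of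
normalised `(N_L, S^z = 0)` sector ground states has `d`-wave pair long-range order along even sides),
into the UNIFORM FLOOR form consumed by the transfer `stub_pairBridgeAt_of_floors`:
`∃ a > 0, ∃ L₀, ∀ even L ≥ L₀` (`L ≠ 0`), every unit ground state `φ` of `(N_L, S^z = 0)` has
`a·L⁴ ≤ ‖Δ_d φ‖²`, `Δ_d = pairField dWaveFormFactor L`, with `‖Δ_d φ‖²` written
`re (star (Δ_d φ) ⬝ᵥ (Δ_d φ))`.

Proof. The tree's `floor_of_hasDWavePairFieldLROAt` (route `WeakCouplingBCS`, negative side) already gives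
the floor in the `∀ᶠ k` shape at sides `2k+2` for `re⟨ψ, Δ_dᴴ Δ_d ψ⟩`; `Filter.eventually_atTop` turns
`∀ᶠ k` into `∃ k₀, ∀ k ≥ k₀`, the Gram identity `⟨ψ, Δ_dᴴ Δ_d ψ⟩ = ⟨Δ_d ψ, Δ_d ψ⟩`
(`PosSemidefTrace.expect_conjTranspose_mul`) rewrites the right-hand side, and an even `L ≠ 0` is
re-indexed as `2k+2`.

Sources: folklore bookkeeping over the finite-volume variational principle, H. Tasaki, *Physics and
Mathematics of Quantum Many-Body Systems* (2020) §2.1–2.2; S. Friedli, Y. Velenik, *Statistical Mechanics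
of Lattice Systems* (2017) §3.7.2 (long-range order as a `liminf`). No definition, no named fact.
-/

noncomputable section

-- the mandated namespace `Summit.<Summit>.<Problem>.Theorems` repeats `HubbardSuperconductivity`
-- (single-problem summit, D-0017), which the `dupNamespace` linter flags on every declaration
set_option linter.dupNamespace false

namespace Summit.HubbardSuperconductivity.HubbardSuperconductivity.Theorems.JosephsonMirror

open Matrix Literature.MathematicalPhysics.QuantumLattice Literature.Barriers.HubbardSuperconductivity
open Filter
open scoped ComplexOrder

/-- The summit matrix at `(U, δ)`, `δ ≥ 0`, as a floor at the sides `2k+2`, `k ≥ k₀`, in the Gram form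
`a·(2k+2)⁴ ≤ ‖Δ_d ψ‖² = re (star (Δ_d ψ) ⬝ᵥ (Δ_d ψ))` for every unit ground state `ψ` of
`(N_{2k+2}, S^z = 0)`: `floor_of_hasDWavePairFieldLROAt`, `Filter.eventually_atTop` and the Gram identity
`⟨ψ, Δ_dᴴ Δ_d ψ⟩ = ⟨Δ_d ψ, Δ_d ψ⟩`. Tasaki (2020) §2.1–2.2. [folklore] -/
theorem lroFloor_atSide_of_hasDWavePairFieldLROAt (U δ : ℝ) (hδ : 0 ≤ δ)
    (h : HasDWavePairFieldLROAt U δ) :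
    ∃ a : ℝ, 0 < a ∧ ∃ k₀ : ℕ, ∀ k : ℕ, k₀ ≤ k →
      ∀ ψ : Fock (Orb (FermionTorus 2 (2 * k + 1 + 1))),
        IsGroundStateInSector (hubbardTorus 2 (2 * k + 1 + 1) 1 U)
            (2 * ⌊(1 - δ) * ((2 * k + 1 + 1 : ℕ) : ℝ) ^ 2 / 2⌋₊) 0 ψ →
          star ψ ⬝ᵥ ψ = 1 →
            a * ((2 * k + 1 + 1 : ℕ) : ℝ) ^ 4 ≤
              (star (pairField dWaveFormFactor (2 * k + 1 + 1) *ᵥ ψ) ⬝ᵥ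
                (pairField dWaveFormFactor (2 * k + 1 + 1) *ᵥ ψ)).re := by
  obtain ⟨a, ha, hev⟩ :=
    Summit.HubbardSuperconductivity.WcbcsSsbToTorusLRO.Negative.floor_of_hasDWavePairFieldLROAt hδ h
  obtain ⟨k₀, hk₀⟩ := Filter.eventually_atTop.1 hev
  refine ⟨a, ha, k₀, fun k hk ψ hψ hψ1 => ?_⟩
  have hfloor := hk₀ k hk ψ hψ hψ1
  rwa [PosSemidefTrace.expect_conjTranspose_mul] at hfloor

/-- **`stub_lroFloorOfHasLRO`** (the summit matrix at `(U, δ)`, `δ ≥ 0`, in `∃ L₀ ∀ even L` floor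
form): `HasDWavePairFieldLROAt U δ` gives `a > 0` and `L₀` such that every normalised ground state `φ` of
`hubbardTorus 2 L 1 U` in `(N_L, S^z = 0)`, `L ≥ L₀` even and `≠ 0`, has `a L⁴ ≤ ‖Δ_d φ‖²`. By
`floor_of_hasDWavePairFieldLROAt` (the `∀ᶠ k`, `L = 2k+2` floor for `re⟨ψ, Δ_dᴴ Δ_d ψ⟩`), the Gram
identity `‖Δ_dψ‖² = ⟨ψ, Δ_dᴴΔ_d ψ⟩`, and the reindexing of even `L ≠ 0` as `2k + 2`.
Tasaki (2020) §2.1–2.2; Friedli–Velenik (2017) §3.7.2. [folklore] -/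
theorem stub_lroFloorOfHasLRO (U δ : ℝ) (hδ : 0 ≤ δ) (h : HasDWavePairFieldLROAt U δ) :
    ∃ a : ℝ, 0 < a ∧ ∃ L₀ : ℕ, ∀ (L : ℕ) [NeZero L], Even L → L₀ ≤ L →
      ∀ φ : Fock (Orb (FermionTorus 2 L)),
        IsGroundStateInSector (hubbardTorus 2 L 1 U) (2 * ⌊(1 - δ) * (L : ℝ) ^ 2 / 2⌋₊) 0 φ →
          star φ ⬝ᵥ φ = 1 →
            a * (L : ℝ) ^ 4 ≤
              (star (pairField dWaveFormFactor L *ᵥ φ) ⬝ᵥ (pairField dWaveFormFactor L *ᵥ φ)).re := by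
  obtain ⟨a, ha, k₀, hk₀⟩ := lroFloor_atSide_of_hasDWavePairFieldLROAt U δ hδ h
  refine ⟨a, ha, 2 * k₀ + 1 + 1, fun L _ hL hL₀ φ hφ hφ1 => ?_⟩
  have hL0 : L ≠ 0 := NeZero.ne L
  obtain ⟨r, hr⟩ := hL
  obtain ⟨k, rfl⟩ : ∃ k : ℕ, L = 2 * k + 1 + 1 := ⟨r - 1, by omega⟩
  exact hk₀ k (by omega) φ hφ hφ1

end Summit.HubbardSuperconductivity.HubbardSuperconductivity.Theorems.JosephsonMirror

end
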